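import Mathlib
import HarnessLib
import Summits.AtomisticToContinuum.Crystallization.Theorems.PricedLinkCensusSoftLayerPropagationStubBallPropagationLayersDown

/-!
# Local layer propagation, HCP case: the frame attached to a presentation of an HCP shell

Route `BrittleRungDescent`, support item `SoftLayerPropagation` (stmt-AtomisticToContinuum-9210),
helper file (η = 0; vocabulary of `LayerShellPatterns.lean`, `LayerPropagation.lean` and the
reflection lemmas of `PricedLinkCensus…LayersDown.lean`).

* `closePackingFrame_image_range_hcpRef` — the HCP layer shell `layerShell σ σ` *is* the image of
  the reference anticuboctahedron `range hcpRef` under the close-packing frame (the tree's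
  `isArrangedIn_layerShell_hcp` with the isometry made explicit).
* `closePackingFrame_apply_two_eq_inner` — the height coordinate of the frame is the inner product
  with the unit normal `n₀ = (1,1,1)/√3` of the mirror plane.
* `exists_frame_of_range_hcpRef` — **frame from a presentation.**  If the shell of `y` in `V` is
  presented as `range (B ∘ hcpRef)` by a linear isometry `B`, there is a frame `L` at `y` in which
  the shell of the origin is `layerShell 1 1`, the moved point `u` lies on or above the base plane,
  and its height is `|⟪u − y, B n₀⟫|` — the distance from `u` to the mirror plane of the shell.

All statements are elementary ([folklore]).
-/

noncomputable section

namespace Summit.AtomisticToContinuum.Crystallization.Theorems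

open Literature.Geometry.DiscreteGeometry Literature.MathematicalPhysics.StatisticalMechanics
open RealInnerProductSpace

/-- The image of the reference anticuboctahedron under the close-packing frame of sign `σ` lies in
the HCP layer shell `layerShell σ σ` (the computation of `isArrangedIn_layerShell_hcp`).
[cite: HalesDSP2012, §1.3 (Fig. 1.11)] -/
theorem closePackingFrame_image_range_hcpRef_subset {σ : ℤ} (hσ : σ = 1 ∨ σ = -1)
    (hσR : (σ : ℝ) = 1 ∨ (σ : ℝ) = -1) :
    closePackingFrame σ hσR '' Set.range hcpRef ⊆ layerShell (σ : ℝ) (σ : ℝ) := by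
  rintro _ ⟨_, ⟨i, rfl⟩, rfl⟩
  have hp : (Real.sqrt ((18 : ℕ) : ℝ))⁻¹ • intVec (hcpTab i) ∈ (hcpKissingPattern : Set _) := by
    rw [Finset.mem_coe, hcpKissingPattern, scaledPattern, Finset.mem_image]
    exact ⟨hcpTab i, by rw [hcpInt_eq_image]; exact Finset.mem_image_of_mem _ (Finset.mem_univ _), rfl⟩
  rw [Finset.mem_coe, hcpKissingPattern, scaledPattern, Finset.mem_image] at hp
  obtain ⟨t, ht, hti⟩ := hp
  obtain ⟨⟨A, B, C⟩, hq, hA, hB, hC⟩ := hcp_shellTable σ (mem_signSet hσ) t ht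
  have hA' : (3 : ℝ) * A = σ * (3 * (t 1 : ℝ) - ((t 0 : ℝ) + t 1 + t 2)) := by exact_mod_cast hA
  have hB' : (3 : ℝ) * B = σ * (3 * (t 2 : ℝ) - ((t 0 : ℝ) + t 1 + t 2)) := by exact_mod_cast hB
  have hC' : (3 : ℝ) * C = (t 0 : ℝ) + t 1 + t 2 := by exact_mod_cast hC
  have key : (2 : ℝ) • closePackingFrame σ hσR ((Real.sqrt ((18 : ℕ) : ℝ))⁻¹ • intVec t) =
      uveCombo ((A : ℝ) / 3) ((B : ℝ) / 3) ((C : ℝ) / 2) := by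
    rw [two_smul_closePackingFrame_smul_intVec, sqrt_eighteen_inv_mul_sqrt_two, ← hA', ← hB',
      ← hC']
    unfold uveCombo
    module
  have e : closePackingFrame σ hσR (hcpRef i) =
      (2 : ℝ) • closePackingFrame σ hσR ((Real.sqrt ((18 : ℕ) : ℝ))⁻¹ • intVec t) := by
    rw [show hcpRef i = refPt 18 (hcpTab i) from rfl, refPt, map_smul, hti]
  rw [e, key]
  exact uveCombo_mem_layerShell hq

/-- **The HCP layer shell is the image of the reference anticuboctahedron under the close-packing
frame** (equality, by counting twelve points on both sides). [cite: HalesDSP2012, §1.3 (Fig. 1.11)] -/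
theorem closePackingFrame_image_range_hcpRef {σ : ℤ} (hσ : σ = 1 ∨ σ = -1)
    (hσR : (σ : ℝ) = 1 ∨ (σ : ℝ) = -1) :
    closePackingFrame σ hσR '' Set.range hcpRef = layerShell (σ : ℝ) (σ : ℝ) := by
  apply Set.eq_of_subset_of_ncard_le (closePackingFrame_image_range_hcpRef_subset hσ hσR) ?_
    (finite_layerShell _ _)
  have hinj : Function.Injective hcpRef :=
    (refPt_injective (N := 18) (by norm_num)).comp hcpTab_injective
  rw [ncard_layerShell hσR hσR, Set.ncard_image_of_injective _ (closePackingFrame σ hσR).injective,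
    Set.ncard_range_of_injective hinj]
  simp

/-- `√2 · 𝗁 / 4 = 1/√3`. [folklore] -/
theorem sqrt_two_mul_layerSpacing_div_four : Real.sqrt 2 * layerSpacing / 4 = (Real.sqrt 3)⁻¹ := by
  have h3 : (0 : ℝ) < Real.sqrt 3 := by positivity
  have hh : (0 : ℝ) < layerSpacing := layerSpacing_pos
  have hsq : (Real.sqrt 2 * layerSpacing / 4) ^ 2 = ((Real.sqrt 3)⁻¹) ^ 2 := by
    rw [div_pow, mul_pow, inv_pow, Real.sq_sqrt (by norm_num : (0 : ℝ) ≤ 2),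
      Real.sq_sqrt (by norm_num : (0 : ℝ) ≤ 3), layerSpacing_sq]
    norm_num
  have h1 : 0 ≤ Real.sqrt 2 * layerSpacing / 4 := by positivity
  have h2 : 0 ≤ (Real.sqrt 3)⁻¹ := by positivity
  nlinarith [hsq, h1, h2, sq_nonneg (Real.sqrt 2 * layerSpacing / 4 - (Real.sqrt 3)⁻¹),
    sq_nonneg (Real.sqrt 2 * layerSpacing / 4 + (Real.sqrt 3)⁻¹)]

/-- **The height coordinate of the close-packing frame is the inner product with the unit normal
`n₀ = (1,1,1)/√3` of the mirror plane.** [folklore] -/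
theorem closePackingFrame_apply_two_eq_inner {σ : ℝ} (hσ : σ = 1 ∨ σ = -1)
    (w : EuclideanSpace ℝ (Fin 3)) :
    closePackingFrame σ hσ w 2 = ⟪w, (Real.sqrt 3)⁻¹ • intVec ![1, 1, 1]⟫ := by
  rw [closePackingFrame_apply, closePackingFrameLin_apply_two, sqrt_two_mul_layerSpacing_div_four,
    inner_smul_right, inner_fin3]
  simp

/-- **Frame from a presentation of an HCP shell.**  If the shell of `y` in `V` is
`range (B ∘ hcpRef)` for a linear isometry `B`, there is a frame `L` at `y` with
`kissingShell {x | y + L x ∈ V} 0 = layerShell 1 1`, the moved point `L⁻¹(u − y)` on or above the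
base plane, and its height equal to `|⟪u − y, B n₀⟫|`. [folklore] -/
theorem exists_frame_of_range_hcpRef {V : Set (EuclideanSpace ℝ (Fin 3))} {y : EuclideanSpace ℝ (Fin 3)}
    (B : EuclideanSpace ℝ (Fin 3) →ₗᵢ[ℝ] EuclideanSpace ℝ (Fin 3)) (u : EuclideanSpace ℝ (Fin 3))
    (h : kissingShell V y = Set.range (fun i => B (hcpRef i))) :
    ∃ L : EuclideanSpace ℝ (Fin 3) ≃ₗᵢ[ℝ] EuclideanSpace ℝ (Fin 3),
      kissingShell {x | y + L x ∈ V} 0 = layerShell 1 1 ∧ 0 ≤ (L.symm (u - y)) 2 ∧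
      |(L.symm (u - y)) 2| = |⟪u - y, B ((Real.sqrt 3)⁻¹ • intVec ![1, 1, 1])⟫| := by
  have h1 : ((1 : ℤ) : ℝ) = 1 ∨ ((1 : ℤ) : ℝ) = -1 := Or.inl (by norm_num)
  set C := (closePackingFrame ((1 : ℤ) : ℝ) h1).toLinearIsometryEquiv rfl with hC
  set Bt := B.toLinearIsometryEquiv rfl with hBt
  set L₀ := C.symm.trans Bt with hL₀
  -- the shell of the origin in the frame `L₀`
  have hshell : kissingShell {x | y + L₀ x ∈ V} 0 = layerShell 1 1 := by
    rw [kissingShell_preimage, map_zero, add_zero, h]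
    have e : layerShell (1 : ℝ) 1 = closePackingFrame ((1 : ℤ) : ℝ) h1 '' Set.range hcpRef := by
      rw [closePackingFrame_image_range_hcpRef (Or.inl rfl) h1]; norm_num
    rw [e]
    have hBt' : ∀ z, Bt z = B z := fun z => LinearIsometry.toLinearIsometryEquiv_apply _ _ z
    have hC' : ∀ z, C z = closePackingFrame ((1 : ℤ) : ℝ) h1 z := fun z =>
      LinearIsometry.toLinearIsometryEquiv_apply _ _ z
    ext x
    simp only [Set.mem_preimage, Set.mem_range, Set.mem_image, hL₀, LinearIsometryEquiv.trans_apply]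
    constructor
    · rintro ⟨i, hi⟩
      have h2 : hcpRef i = C.symm x := Bt.injective (by rw [hBt', hi])
      exact ⟨hcpRef i, ⟨i, rfl⟩, by rw [← hC', h2, LinearIsometryEquiv.apply_symm_apply]⟩
    · rintro ⟨_, ⟨i, rfl⟩, hx⟩
      exact ⟨i, by rw [← hx, ← hC', LinearIsometryEquiv.symm_apply_apply, hBt']⟩
  -- the height in the frame `L₀`
  have hheight : (L₀.symm (u - y)) 2 = ⟪u - y, B ((Real.sqrt 3)⁻¹ • intVec ![1, 1, 1])⟫ := by
    have e1 : L₀.symm (u - y) = C (Bt.symm (u - y)) := by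
      rw [hL₀]; rfl
    rw [e1, hC, LinearIsometry.toLinearIsometryEquiv_apply, closePackingFrame_apply_two_eq_inner,
      ← Bt.inner_map_map, LinearIsometryEquiv.apply_symm_apply, hBt,
      LinearIsometry.toLinearIsometryEquiv_apply]
  by_cases hsgn : 0 ≤ (L₀.symm (u - y)) 2
  · exact ⟨L₀, hshell, hsgn, by rw [hheight]⟩
  · set Rf := ((ℝ ∙ (layerNormal layerSpacing : EuclideanSpace ℝ (Fin 3)))ᗮ).reflection with hRf
    refine ⟨Rf.trans L₀, ?_, ?_, ?_⟩
    · have e : {x | y + (Rf.trans L₀) x ∈ V} = {x | Rf x ∈ {x | y + L₀ x ∈ V}} := by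
        ext x; simp [LinearIsometryEquiv.trans_apply]
      rw [e, kissingShell_reflected, map_zero, hshell, preimage_baseReflection_layerShell]
    · have e : (Rf.trans L₀).symm (u - y) = Rf (L₀.symm (u - y)) := by
        apply (Rf.trans L₀).injective
        rw [LinearIsometryEquiv.apply_symm_apply, LinearIsometryEquiv.trans_apply, hRf,
          baseReflection_baseReflection, LinearIsometryEquiv.apply_symm_apply]
      rw [e, baseReflection_apply_two]
      linarith
    · have e : (Rf.trans L₀).symm (u - y) = Rf (L₀.symm (u - y)) := by
        apply (Rf.trans L₀).injective
        rw [LinearIsometryEquiv.apply_symm_apply, LinearIsometryEquiv.trans_apply, hRf,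
          baseReflection_baseReflection, LinearIsometryEquiv.apply_symm_apply]
      rw [e, baseReflection_apply_two, abs_neg, hheight]

end Summit.AtomisticToContinuum.Crystallization.Theorems
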